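import Summits.Ventures.HodgeRepro2.T5CocompactUnimodular
import Mathlib.MeasureTheory.Measure.Haar.Quotient

/-!
# T5RightPeriodize — the right `Γ`-periodisation `Σ_γ f (x γ)` and its descent to `G ⧸ Γ`

Cell pub-hodge-repro2, seat p5, Tier 5 (route/T5-N4-p5.md, N4.3 v13 (A3) STEP 1 / (B2)).  Row 64
(`T5CocompactUnimodular`) periodises on the LEFT (`Σ_γ ψ (γ x)`, the function on `Γ\G`).  The
quotient `G ⧸ Γ` of rows 59 / 61 / 65 carries the RIGHT action of `Γ.op`, and the function on it
is the right periodisation `x ↦ Σ_γ f (x γ)`, Mathlib's `QuotientGroup.automorphize` (a `tsum`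
over `Γ.op`).  This file provides, for a discrete `Γ` of a Hausdorff locally compact `G`:

* `periodizeR Γ f x = ∑ᶠ γ : Γ, f (x * γ)`, with `periodizeR_eq_periodize_inv` (it is the left
  periodisation of `f ∘ (·⁻¹)` at `x⁻¹`), `continuous_periodizeR`, `finite_setOf_mul_mem_support`
  (finite fibre sums), `periodizeR_mul_mem` (right `Γ`-invariance), `periodizeR_mul_left`;
* `autoR Γ f : G ⧸ Γ → ℝ`, its descent (`autoR_mk`), `continuous_autoR`, and the identification
  `autoR_eq_automorphize` with Mathlib's `QuotientGroup.automorphize` (so the Unfolding Trick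
  `QuotientGroup.integral_eq_integral_automorphize` applies to it);
* linearity and positivity on compactly supported functions: `autoR_add`, `autoR_smul`,
  `autoR_sub`, `autoR_nonneg`, `autoR_mono`, `autoR_comp_mul_left` (`autoR (f (g ·)) q = autoR f (g • q)`);
* `exists_periodizeR_eq_one`: a RIGHT partition of unity along `Γ` when `G ⧸ Γ` is compact (row 64's
  left one composed with the inversion), and `autoR_mul_comp_mk`: every function `h` on `G ⧸ Γ` is
  `autoR (φ · (h ∘ mk))` — `autoR` is onto `C(G ⧸ Γ)`.

Imports row 64 and Mathlib.  Axioms: propext, Classical.choice, Quot.sound.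
README §8(d): uses an L-value-free non-vanishing device: NO.
-/

namespace Summit.Ventures.HodgeRepro2.T5RightPeriodize

open MeasureTheory Set Function Filter Topology
open scoped Pointwise
open Summit.Ventures.HodgeRepro2.T5CocompactUnimodular (periodize)

variable {G : Type*} [Group G] [TopologicalSpace G] [IsTopologicalGroup G] (Γ : Subgroup G)

/-- The right `Γ`-periodisation `x ↦ Σ_γ f (x γ)` (a finite sum at every point for `f` with
compact support and `Γ` discrete). -/
noncomputable def periodizeR (f : G → ℝ) (x : G) : ℝ :=
  ∑ᶠ γ : Γ, f (x * γ)

variable {Γ}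

omit [TopologicalSpace G] [IsTopologicalGroup G] in
/-- The right periodisation is the left one of `f ∘ (·⁻¹)` at `x⁻¹`. -/
theorem periodizeR_eq_periodize_inv (f : G → ℝ) (x : G) :
    periodizeR Γ f x = periodize Γ (f ∘ Inv.inv) x⁻¹ :=
  calc periodizeR Γ f x = ∑ᶠ γ : Γ, f (x * ((Equiv.inv Γ γ : Γ) : G)) :=
        (finsum_comp_equiv (Equiv.inv Γ) (f := fun γ : Γ => f (x * γ))).symm
    _ = ∑ᶠ γ : Γ, (f ∘ Inv.inv) ((γ : G) * x⁻¹) := by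
        simp only [Function.comp_apply, Equiv.inv_apply, Subgroup.coe_inv, mul_inv_rev, inv_inv]
    _ = periodize Γ (f ∘ Inv.inv) x⁻¹ := rfl

omit [TopologicalSpace G] [IsTopologicalGroup G] in
/-- `periodizeR` as a function: `periodizeR Γ f = periodize Γ (f ∘ (·⁻¹)) ∘ (·⁻¹)`. -/
theorem periodizeR_eq (f : G → ℝ) : periodizeR Γ f = periodize Γ (f ∘ Inv.inv) ∘ Inv.inv :=
  funext fun x => periodizeR_eq_periodize_inv f x

omit [IsTopologicalGroup G] in
/-- For a compact `L` and `f` with compact support, only finitely many `γ ∈ Γ` have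
`f (x * γ) ≠ 0` for some `x ∈ L` (row 64's lemma for the left action, transported by the
inversion). -/
theorem finite_setOf_mul_mem_support [ContinuousInv G] [ProperlyDiscontinuousSMul Γ G]
    {f : G → ℝ} (hf : HasCompactSupport f) {L : Set G} (hL : IsCompact L) :
    {γ : Γ | ∃ x ∈ L, f (x * γ) ≠ 0}.Finite := by
  have h := (T5CocompactUnimodular.finite_setOf_mul_mem_support
    (hf.comp_homeomorph (Homeomorph.inv G)) hL.inv).image (Equiv.inv Γ)
  refine h.subset ?_
  rintro γ ⟨x, hx, hne⟩
  refine ⟨γ⁻¹, ⟨x⁻¹, Set.inv_mem_inv.2 hx, ?_⟩, by simp⟩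
  simpa [mul_inv_rev] using hne

omit [IsTopologicalGroup G] in
/-- The fibre sum at a point has finite support. -/
theorem hasFiniteSupport_mul [ContinuousInv G] [ProperlyDiscontinuousSMul Γ G] {f : G → ℝ}
    (hf : HasCompactSupport f) (x : G) : HasFiniteSupport fun γ : Γ => f (x * γ) :=
  (finite_setOf_mul_mem_support hf isCompact_singleton).subset
    fun _ hγ => ⟨x, mem_singleton x, hγ⟩

/-- The right periodisation of a continuous function with compact support is continuous. -/
theorem continuous_periodizeR [WeaklyLocallyCompactSpace G] [ProperlyDiscontinuousSMul Γ G]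
    {f : G → ℝ} (hfc : Continuous f) (hfs : HasCompactSupport f) :
    Continuous (periodizeR Γ f) := by
  rw [periodizeR_eq]
  exact (T5CocompactUnimodular.continuous_periodize (hfc.comp continuous_inv)
    (hfs.comp_homeomorph (Homeomorph.inv G))).comp continuous_inv

omit [TopologicalSpace G] [IsTopologicalGroup G] in
/-- Right `Γ`-invariance: `periodizeR Γ f (x * γ) = periodizeR Γ f x` for `γ ∈ Γ`. -/
theorem periodizeR_mul_mem (f : G → ℝ) (x : G) {γ : G} (hγ : γ ∈ Γ) :
    periodizeR Γ f (x * γ) = periodizeR Γ f x :=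
  calc periodizeR Γ f (x * γ)
      = ∑ᶠ γ' : Γ, f (x * ((Equiv.mulLeft (⟨γ, hγ⟩ : Γ) γ' : Γ) : G)) := by
        simp only [periodizeR, Equiv.coe_mulLeft, Subgroup.coe_mul, mul_assoc]
    _ = periodizeR Γ f x :=
        finsum_comp_equiv (Equiv.mulLeft (⟨γ, hγ⟩ : Γ)) (f := fun γ' : Γ => f (x * γ'))

omit [TopologicalSpace G] [IsTopologicalGroup G] in
/-- Periodising a left translate: `periodizeR Γ (f (g * ·)) x = periodizeR Γ f (g * x)`. -/
theorem periodizeR_mul_left (f : G → ℝ) (g x : G) :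
    periodizeR Γ (fun y => f (g * y)) x = periodizeR Γ f (g * x) := by
  simp only [periodizeR, mul_assoc]

/-! ### Descent to the quotient -/

variable (Γ) in
/-- The descended periodisation `autoR Γ f : G ⧸ Γ → ℝ`, `autoR Γ f (mk x) = Σ_γ f (x γ)`. -/
noncomputable def autoR (f : G → ℝ) : G ⧸ Γ → ℝ :=
  Quotient.lift (periodizeR Γ f) fun x y hxy => by
    have h : x⁻¹ * y ∈ Γ := QuotientGroup.leftRel_apply.1 hxy
    calc periodizeR Γ f x = periodizeR Γ f (x * (x⁻¹ * y)) := (periodizeR_mul_mem f x h).symm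
      _ = periodizeR Γ f y := by rw [mul_inv_cancel_left]

omit [TopologicalSpace G] [IsTopologicalGroup G] in
/-- `autoR` on classes. -/
theorem autoR_mk (f : G → ℝ) (x : G) : autoR Γ f (x : G ⧸ Γ) = periodizeR Γ f x :=
  rfl

/-- `autoR Γ f` is continuous for `f` continuous with compact support. -/
theorem continuous_autoR [WeaklyLocallyCompactSpace G] [ProperlyDiscontinuousSMul Γ G]
    {f : G → ℝ} (hfc : Continuous f) (hfs : HasCompactSupport f) :
    Continuous (autoR Γ f) :=
  continuous_quot_lift _ (continuous_periodizeR hfc hfs)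

omit [TopologicalSpace G] [IsTopologicalGroup G] in
/-- The opposite of `γ ∈ Γ` acts by right multiplication: `(Γ.equivOp γ) • x = x * γ`. -/
theorem equivOp_smul (γ : Γ) (x : G) : (Subgroup.equivOp Γ γ) • x = x * γ := by
  simp [Subgroup.smul_def, Subgroup.equivOp_apply_coe, MulOpposite.smul_eq_mul_unop]

omit [IsTopologicalGroup G] in
/-- **`autoR` is Mathlib's `QuotientGroup.automorphize`** on functions with compact support (the
`tsum` over `Γ.op` is the finite sum over `Γ`). -/
theorem autoR_eq_automorphize [ContinuousInv G] [ProperlyDiscontinuousSMul Γ G] {f : G → ℝ}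
    (hf : HasCompactSupport f) : autoR Γ f = QuotientGroup.automorphize f := by
  ext q
  induction q using QuotientGroup.induction_on with
  | H x =>
    show periodizeR Γ f x = ∑' γ : Γ.op, f (γ • x)
    have hfin : HasFiniteSupport fun γ : Γ.op => f (γ • x) := by
      refine ((hasFiniteSupport_mul hf x).image (Subgroup.equivOp Γ)).subset fun γ' hγ' => ?_
      refine ⟨(Subgroup.equivOp Γ).symm γ', ?_, Equiv.apply_symm_apply _ _⟩
      show f (x * ((Subgroup.equivOp Γ).symm γ' : G)) ≠ 0
      rw [← equivOp_smul, Equiv.apply_symm_apply]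
      exact hγ'
    rw [tsum_eq_finsum hfin]
    calc periodizeR Γ f x = ∑ᶠ γ : Γ, f ((Subgroup.equivOp Γ γ) • x) := by
          simp only [periodizeR, equivOp_smul]
      _ = ∑ᶠ γ : Γ.op, f (γ • x) :=
          finsum_comp_equiv (Subgroup.equivOp Γ) (f := fun γ : Γ.op => f (γ • x))

/-! ### Linearity, positivity, translation -/

section Linear

variable [ContinuousInv G] [ProperlyDiscontinuousSMul Γ G]

omit [IsTopologicalGroup G] in
/-- `autoR` is additive on compactly supported functions. -/
theorem autoR_add {f g : G → ℝ} (hf : HasCompactSupport f) (hg : HasCompactSupport g) :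
    autoR Γ (f + g) = autoR Γ f + autoR Γ g := by
  ext q
  induction q using QuotientGroup.induction_on with
  | H x =>
    show ∑ᶠ γ : Γ, (f (x * γ) + g (x * γ)) = ∑ᶠ γ : Γ, f (x * γ) + ∑ᶠ γ : Γ, g (x * γ)
    exact finsum_add_distrib (hasFiniteSupport_mul hf x) (hasFiniteSupport_mul hg x)

omit [TopologicalSpace G] [IsTopologicalGroup G] [ContinuousInv G] [ProperlyDiscontinuousSMul Γ G] in
/-- `autoR` commutes with scalars. -/
theorem autoR_smul (c : ℝ) (f : G → ℝ) : autoR Γ (c • f) = c • autoR Γ f := by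
  ext q
  induction q using QuotientGroup.induction_on with
  | H x =>
    show ∑ᶠ γ : Γ, c * f (x * γ) = c * ∑ᶠ γ : Γ, f (x * γ)
    exact (mul_finsum _ _).symm

omit [IsTopologicalGroup G] in
/-- `autoR` is subtractive on compactly supported functions. -/
theorem autoR_sub {f g : G → ℝ} (hf : HasCompactSupport f) (hg : HasCompactSupport g) :
    autoR Γ (f - g) = autoR Γ f - autoR Γ g := by
  ext q
  induction q using QuotientGroup.induction_on with
  | H x =>
    show ∑ᶠ γ : Γ, (f (x * γ) - g (x * γ)) = ∑ᶠ γ : Γ, f (x * γ) - ∑ᶠ γ : Γ, g (x * γ)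
    exact finsum_sub_distrib (hasFiniteSupport_mul hf x) (hasFiniteSupport_mul hg x)

omit [TopologicalSpace G] [IsTopologicalGroup G] [ContinuousInv G] [ProperlyDiscontinuousSMul Γ G] in
/-- `autoR` of a nonnegative function is nonnegative. -/
theorem autoR_nonneg {f : G → ℝ} (hf : ∀ x, 0 ≤ f x) (q : G ⧸ Γ) : 0 ≤ autoR Γ f q := by
  induction q using QuotientGroup.induction_on with
  | H x => exact finsum_nonneg fun γ => hf _

omit [IsTopologicalGroup G] in
/-- `autoR` is monotone on compactly supported functions. -/
theorem autoR_mono {f g : G → ℝ} (hf : HasCompactSupport f) (hg : HasCompactSupport g)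
    (hfg : f ≤ g) : autoR Γ f ≤ autoR Γ g := fun q => by
  have h := autoR_nonneg (Γ := Γ) (f := g - f) (fun x => sub_nonneg.2 (hfg x)) q
  rw [autoR_sub hg hf, Pi.sub_apply, sub_nonneg] at h
  exact h

end Linear

omit [TopologicalSpace G] [IsTopologicalGroup G] in
/-- Left translation: `autoR Γ (f (g * ·)) q = autoR Γ f (g • q)`. -/
theorem autoR_comp_mul_left (f : G → ℝ) (g : G) (q : G ⧸ Γ) :
    autoR Γ (fun y => f (g * y)) q = autoR Γ f (g • q) := by
  induction q using QuotientGroup.induction_on with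
  | H x =>
    rw [MulAction.Quotient.smul_mk, autoR_mk, autoR_mk, periodizeR_mul_left]
    rfl

/-! ### Partition of unity and surjectivity -/

/-- **A right partition of unity along `Γ`**: `G ⧸ Γ` compact, `G` locally compact Hausdorff,
`Γ` discrete ⇒ a continuous `φ ≥ 0` with compact support and `Σ_γ φ (x γ) = 1` for every `x`
(row 64's left partition of unity composed with the inversion). -/
theorem exists_periodizeR_eq_one [T2Space G] [LocallyCompactSpace G] (Γ : Subgroup G)
    [DiscreteTopology Γ] [CompactSpace (G ⧸ Γ)] :
    ∃ φ : G → ℝ, Continuous φ ∧ HasCompactSupport φ ∧ (∀ x, 0 ≤ φ x) ∧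
      ∀ x, periodizeR Γ φ x = 1 := by
  obtain ⟨ψ, hψc, hψs, hψ0, -, hψ1⟩ := T5CocompactUnimodular.exists_periodize_eq_one Γ
  refine ⟨ψ ∘ Inv.inv, hψc.comp continuous_inv, hψs.comp_homeomorph (Homeomorph.inv G),
    fun x => hψ0 _, fun x => ?_⟩
  rw [periodizeR_eq_periodize_inv]
  have : (ψ ∘ Inv.inv) ∘ Inv.inv = ψ := by ext y; simp
  rw [this, hψ1]

omit [TopologicalSpace G] [IsTopologicalGroup G] in
/-- **`autoR` is onto**: for a right partition of unity `φ` and any `h : G ⧸ Γ → ℝ`,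
`autoR Γ (φ · (h ∘ mk)) = h`. -/
theorem autoR_mul_comp_mk {φ : G → ℝ} (hφ1 : ∀ x, periodizeR Γ φ x = 1) (h : G ⧸ Γ → ℝ)
    (q : G ⧸ Γ) : autoR Γ (fun x => φ x * h (x : G ⧸ Γ)) q = h q := by
  induction q using QuotientGroup.induction_on with
  | H x =>
    have hx : ∀ γ : Γ, ((x * γ : G) : G ⧸ Γ) = (x : G ⧸ Γ) := fun γ =>
      (QuotientGroup.eq.2 (by simp)).symm
    show ∑ᶠ γ : Γ, φ (x * γ) * h ((x * γ : G) : G ⧸ Γ) = h x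
    simp_rw [hx]
    rw [← finsum_mul]
    show periodizeR Γ φ x * h x = h x
    rw [hφ1, one_mul]

end Summit.Ventures.HodgeRepro2.T5RightPeriodize
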